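import Mathlib.Analysis.Calculus.FDeriv.Basic
import Mathlib.Analysis.SpecificLimits.Normed
import Mathlib.Topology.Algebra.Module.FiniteDimension
import HarnessLib

/-!
# Germs commuting with a dilation are linear (the uniqueness half of Koenigs' linearisation theorem), and the
# scaling ("follow the orbit") extension of a dilation-equivariant identity from a ball to the whole space

[Milnor2006, §8 Thm. 8.2 (Koenigs linearisation) — uniqueness clause and its proof; Cor. 8.4 (global extension along
orbits)] (= the 1990 Stony Brook lectures, arXiv:math/9201272, Thm. 6.1 and Cor. 6.4).  Milnor's uniqueness argument: a
holomorphic germ `η` at `0` commuting with `w ↦ λ w`, `|λ| ≠ 0, 1`, is LINEAR (compare power-series coefficients: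
`λ bₙ = bₙ λⁿ`).  We record the several-variable ∕ normed-space form of this fact with a proof that uses ONLY the
derivative at the fixed point (no power series, any nontrivially normed field `𝕜`): if `Φ (c⁻¹ • z) = c⁻¹ • Φ z` on a
set stable under `c⁻¹ •` (`1 < ‖c‖`), `Φ 0 = 0` and `Φ` has Fréchet derivative `L` at `0`, then iterating gives
`Φ z = cᵏ • Φ (c⁻ᵏ • z) = L z + cᵏ • o(c⁻ᵏ)`, so `Φ = L` on the set (`eqOn_of_hasFDerivAt_of_smul_inv_equivariant`).
Milnor's Cor. 8.4 recipe («follow the orbit until very close to the fixed point, evaluate, multiply by `λ⁻ⁿ`») is the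
second theorem: two maps `f g : E → M` into ANY type that intertwine `c •` with a self-map `D` of `M` and agree on a
ball around `0` agree everywhere (`eq_of_smul_equivariant_of_eqOn_ball`).

The two combine to the abstract «doubling-equivariant maps factor through a linear map» statement used for relative
exponentials of abelian schemes built from the analytified doubling map `[2]` (floor-0 programme P6, crux `HLiu418`,
would-be line L8 «road B», organ B4 «DBLADD» — HOME-only prep; this file is its token-free normed-space core and makes
no manifold statement): if `π, f : E → M` both intertwine `c •` with `D`, `π` is injective on a ball, `σ` inverts `π`
on `f` of a small ball, `σ (f 0) = 0` and `σ ∘ f` is differentiable at `0` with derivative `L`, then `f = π ∘ L`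
(`eq_comp_of_smul_equivariant`); if moreover `f` is injective near `0` then `L` is injective
(`injective_of_smul_equivariant`), hence in finite dimension a linear automorphism (`exists_continuousLinearEquiv_eq_comp`).

THEOREMS ONLY (no `def`, no instance, no notation); Mathlib-only imports.

## References
* [Milnor2006] J. Milnor, *Dynamics in One Complex Variable*, 3rd ed., Ann. of Math. Stud. 160 (2006), §8: Thm. 8.2, Cor. 8.4.
-/

namespace Literature.Analysis.Calculus.DilationEquivariantGerm

open Filter Topology Metric Set

variable {𝕜 : Type*} [NontriviallyNormedField 𝕜] {E F : Type*} [NormedAddCommGroup E] [NormedSpace 𝕜 E]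
  [NormedAddCommGroup F] [NormedSpace 𝕜 F]

/-! ## §0 Iterating the equivariance -/

section Iterates

variable {c : 𝕜}

/-- `‖c⁻¹‖ < 1` when `1 < ‖c‖`. [cite: Milnor2006, §8 Thm. 8.2] -/
theorem norm_inv_lt_one (hc : 1 < ‖c‖) : ‖c⁻¹‖ < 1 := by
  rw [norm_inv]
  exact inv_lt_one_of_one_lt₀ hc

/-- `c ≠ 0` when `1 < ‖c‖`. [cite: Milnor2006, §8 Thm. 8.2] -/
theorem ne_zero_of_one_lt_norm (hc : 1 < ‖c‖) : c ≠ 0 := by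
  rintro rfl
  rw [norm_zero] at hc
  exact absurd hc (not_lt.mpr zero_le_one)

/-- A set stable under `c⁻¹ •` is stable under `(c⁻¹) ^ k •`. [cite: Milnor2006, §8 Thm. 8.2] -/
theorem inv_pow_smul_mem {s : Set E} (hs : ∀ z ∈ s, c⁻¹ • z ∈ s) {z : E} (hz : z ∈ s) (k : ℕ) :
    (c⁻¹) ^ k • z ∈ s := by
  induction k with
  | zero => simpa using hz
  | succ k ih =>
    rw [pow_succ', mul_smul]
    exact hs _ ih

/-- Iterated equivariance: `Φ (c⁻ᵏ • z) = c⁻ᵏ • Φ z`. [cite: Milnor2006, §8 Thm. 8.2, proof of uniqueness] -/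
theorem apply_inv_pow_smul {s : Set E} (hs : ∀ z ∈ s, c⁻¹ • z ∈ s) {Φ : E → F}
    (heq : ∀ z ∈ s, Φ (c⁻¹ • z) = c⁻¹ • Φ z) {z : E} (hz : z ∈ s) (k : ℕ) :
    Φ ((c⁻¹) ^ k • z) = (c⁻¹) ^ k • Φ z := by
  induction k with
  | zero => simp
  | succ k ih =>
    rw [pow_succ', mul_smul, heq _ (inv_pow_smul_mem hs hz k), ih, ← mul_smul]

/-- Iterated forward equivariance into any type: `f (cᵏ • w) = D^[k] (f w)`. [cite: Milnor2006, §8 Cor. 8.4] -/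
theorem apply_pow_smul {M : Type*} {D : M → M} {f : E → M} (hf : ∀ z, f (c • z) = D (f z)) (w : E) (k : ℕ) :
    f (c ^ k • w) = D^[k] (f w) := by
  induction k with
  | zero => simp
  | succ k ih =>
    rw [pow_succ', mul_smul, hf, ih, ← Function.iterate_succ_apply' D k (f w)]

/-- `cᵏ • c⁻ᵏ • z = z`. [cite: Milnor2006, §8 Cor. 8.4] -/
theorem pow_smul_inv_pow_smul (hc : c ≠ 0) (z : E) (k : ℕ) : c ^ k • (c⁻¹) ^ k • z = z := by
  rw [smul_smul, ← mul_pow, mul_inv_cancel₀ hc, one_pow, one_smul]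

/-- A ball around `0` is stable under `c⁻¹ •` when `1 < ‖c‖`. [cite: Milnor2006, §8 Thm. 8.2] -/
theorem inv_smul_mem_ball (hc : 1 < ‖c‖) {r : ℝ} {z : E} (hz : z ∈ ball (0 : E) r) : c⁻¹ • z ∈ ball (0 : E) r := by
  rw [mem_ball_zero_iff] at hz ⊢
  calc ‖c⁻¹ • z‖ = ‖c⁻¹‖ * ‖z‖ := norm_smul _ _
    _ ≤ 1 * ‖z‖ := by gcongr; exact (norm_inv_lt_one hc).le
    _ = ‖z‖ := one_mul _
    _ < r := hz

end Iterates

/-! ## §1 Koenigs uniqueness: a germ commuting with a dilation is its own derivative -/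

/-- **[Milnor2006, Thm. 8.2, uniqueness clause] in normed-space form.**  Let `1 < ‖c‖`, `s ⊆ E` stable under `c⁻¹ •`,
`Φ : E → F` with `Φ 0 = 0`, Fréchet derivative `L` at `0`, and `Φ (c⁻¹ • z) = c⁻¹ • Φ z` for `z ∈ s`.  Then `Φ = L`
on `s`.  (Proof: `Φ z - L z = cᵏ • (Φ - L) (c⁻ᵏ • z)` and the right-hand side is `cᵏ • o(‖c⁻ᵏ • z‖) → 0`.)
[cite: Milnor2006, §8 Thm. 8.2 (Koenigs linearisation), uniqueness clause and its proof] -/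
theorem eqOn_of_hasFDerivAt_of_smul_inv_equivariant {c : 𝕜} (hc : 1 < ‖c‖) {s : Set E}
    (hs : ∀ z ∈ s, c⁻¹ • z ∈ s) {Φ : E → F} {L : E →L[𝕜] F} (hΦ : HasFDerivAt Φ L 0) (h0 : Φ 0 = 0)
    (heq : ∀ z ∈ s, Φ (c⁻¹ • z) = c⁻¹ • Φ z) : EqOn Φ L s := by
  intro z hz
  have hc0 : c ≠ 0 := ne_zero_of_one_lt_norm hc
  have hcinv : ‖c⁻¹‖ < 1 := norm_inv_lt_one hc
  -- the orbit `h k := c⁻ᵏ • z → 0`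
  set h : ℕ → E := fun k => (c⁻¹) ^ k • z with hh
  have htend : Tendsto h atTop (𝓝 0) := by
    simpa [hh] using (tendsto_pow_atTop_nhds_zero_of_norm_lt_one hcinv).smul_const z
  -- the little-o expansion of `Φ` at `0`, sampled along the orbit
  have hlo : (fun x => Φ (0 + x) - Φ 0 - L x) =o[𝓝 0] fun x => x :=
    (hasFDerivAt_iff_isLittleO_nhds_zero).1 hΦ
  have hlo' := hlo.comp_tendsto htend
  -- along the orbit everything is an exact multiple of `Φ z - L z`
  have hval : ∀ k, ((fun x => Φ (0 + x) - Φ 0 - L x) ∘ h) k = (c⁻¹) ^ k • (Φ z - L z) := by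
    intro k
    simp only [Function.comp_apply, hh, zero_add, h0, sub_zero, map_smul, smul_sub]
    rw [apply_inv_pow_smul hs heq hz k]
  have key : ∀ ε : ℝ, 0 < ε → ‖Φ z - L z‖ ≤ ε * ‖z‖ := by
    intro ε hε
    obtain ⟨k, hk⟩ := (hlo'.def hε).exists
    rw [hval k] at hk
    simp only [Function.comp_apply, hh, norm_smul, norm_pow] at hk
    have hpos : 0 < ‖c⁻¹‖ ^ k := pow_pos (norm_pos_iff.mpr (inv_ne_zero hc0)) k
    rw [mul_left_comm] at hk
    exact le_of_mul_le_mul_left hk hpos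
  have hzero : ‖Φ z - L z‖ ≤ 0 := by
    refine le_of_forall_pos_le_add fun ε hε => ?_
    have := key (ε / (‖z‖ + 1)) (by positivity)
    calc ‖Φ z - L z‖ ≤ ε / (‖z‖ + 1) * ‖z‖ := this
      _ ≤ ε / (‖z‖ + 1) * (‖z‖ + 1) := by gcongr; linarith
      _ = ε := by field_simp
      _ = 0 + ε := (zero_add ε).symm
  exact sub_eq_zero.mp (norm_le_zero_iff.mp hzero)

/-- The ball version of `eqOn_of_hasFDerivAt_of_smul_inv_equivariant`.
[cite: Milnor2006, §8 Thm. 8.2 (Koenigs linearisation), uniqueness clause] -/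
theorem eqOn_ball_of_hasFDerivAt_of_smul_inv_equivariant {c : 𝕜} (hc : 1 < ‖c‖) {r : ℝ}
    {Φ : E → F} {L : E →L[𝕜] F} (hΦ : HasFDerivAt Φ L 0) (h0 : Φ 0 = 0)
    (heq : ∀ z ∈ ball (0 : E) r, Φ (c⁻¹ • z) = c⁻¹ • Φ z) : EqOn Φ L (ball 0 r) :=
  eqOn_of_hasFDerivAt_of_smul_inv_equivariant hc (fun _ hz => inv_smul_mem_ball hc hz) hΦ h0 heq

/-! ## §2 «Follow the orbit»: equivariant maps agreeing near `0` agree everywhere -/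

/-- **[Milnor2006, Cor. 8.4] recipe, abstract form.**  `1 < ‖c‖`; `f g : E → M` (any type `M`) with
`f (c • z) = D (f z)`, `g (c • z) = D (g z)`; if `f = g` on a ball `ball 0 r`, `0 < r`, then `f = g`.
[cite: Milnor2006, §8 Cor. 8.4 (global extension of the Koenigs coordinate along orbits)] -/
theorem eq_of_smul_equivariant_of_eqOn_ball {M : Type*} {c : 𝕜} (hc : 1 < ‖c‖) {D : M → M} {f g : E → M}
    (hf : ∀ z, f (c • z) = D (f z)) (hg : ∀ z, g (c • z) = D (g z)) {r : ℝ} (hr : 0 < r)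
    (hfg : EqOn f g (ball 0 r)) : f = g := by
  funext z
  have hc0 : c ≠ 0 := ne_zero_of_one_lt_norm hc
  obtain ⟨k, hk⟩ := exists_pow_lt_of_lt_one (div_pos hr (by positivity : (0 : ℝ) < ‖z‖ + 1))
    (norm_inv_lt_one hc)
  have hmem : (c⁻¹) ^ k • z ∈ ball (0 : E) r := by
    rw [mem_ball_zero_iff, norm_smul, norm_pow]
    calc ‖c⁻¹‖ ^ k * ‖z‖ ≤ ‖c⁻¹‖ ^ k * (‖z‖ + 1) := by gcongr; linarith
      _ < r / (‖z‖ + 1) * (‖z‖ + 1) := by gcongr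
      _ = r := by field_simp
  rw [← pow_smul_inv_pow_smul hc0 z k, apply_pow_smul hf, apply_pow_smul hg, hfg hmem]

/-! ## §3 Doubling-equivariant maps factor through their linear part -/

/-- **Abstract «DBLADD» core.**  `1 < ‖c‖`; `π f : E → M` intertwine `c •` with `D : M → M`; `π` is injective on
`ball 0 ρ`; `σ : M → E` satisfies `π (σ (f w)) = f w` for `w ∈ ball 0 r` and `σ (f 0) = 0`; `σ ∘ f` has Fréchet
derivative `L` at `0`.  Then `f = π ∘ L`.  (Near `0`, `F := σ ∘ f` satisfies `F (c⁻¹ • z) = c⁻¹ • F z` by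
`π`-injectivity, so `F = L` by §1 and `f = π ∘ L` near `0`; §2 spreads it.)
[cite: Milnor2006, §8 Thm. 8.2 (uniqueness) and Cor. 8.4] -/
theorem eq_comp_of_smul_equivariant {M : Type*} {c : 𝕜} (hc : 1 < ‖c‖) {D : M → M} {π f : E → M} {σ : M → E}
    (hπ : ∀ z, π (c • z) = D (π z)) (hf : ∀ z, f (c • z) = D (f z))
    {ρ r : ℝ} (hρ : 0 < ρ) (hr : 0 < r) (hinj : InjOn π (ball 0 ρ))
    (hσ : ∀ w ∈ ball (0 : E) r, π (σ (f w)) = f w) (h0 : σ (f 0) = 0)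
    {L : E →L[𝕜] E} (hL : HasFDerivAt (σ ∘ f) L 0) :
    f = fun z => π (L z) := by
  have hc0 : c ≠ 0 := ne_zero_of_one_lt_norm hc
  have hc1 : 1 ≤ ‖c‖ := hc.le
  have hcpos : 0 < ‖c‖ := lt_of_lt_of_le one_pos hc1
  -- smallness: `σ (f w) ∈ ball 0 (ρ / ‖c‖)` near `0`
  have hcont : ContinuousAt (σ ∘ f) 0 := hL.continuousAt
  obtain ⟨r₁, hr₁, hsmall⟩ : ∃ r₁ > 0, ∀ w ∈ ball (0 : E) r₁, ‖σ (f w)‖ < ρ / ‖c‖ := by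
    have h := (Metric.continuousAt_iff.mp hcont) (ρ / ‖c‖) (div_pos hρ hcpos)
    obtain ⟨δ, hδ, hδ'⟩ := h
    refine ⟨δ, hδ, fun w hw => ?_⟩
    have := hδ' (by simpa [dist_zero_right] using hw)
    simpa [Function.comp_apply, h0, dist_zero_right] using this
  -- the equivariance of `F := σ ∘ f` on the small ball
  set r₂ := min r r₁ with hr₂def
  have hr₂ : 0 < r₂ := lt_min hr hr₁
  have hballr : ∀ {w : E}, w ∈ ball (0 : E) r₂ → w ∈ ball (0 : E) r := fun hw =>
    ball_subset_ball (min_le_left _ _) hw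
  have hballr₁ : ∀ {w : E}, w ∈ ball (0 : E) r₂ → w ∈ ball (0 : E) r₁ := fun hw =>
    ball_subset_ball (min_le_right _ _) hw
  have hFeq : ∀ z ∈ ball (0 : E) r₂, (σ ∘ f) (c⁻¹ • z) = c⁻¹ • (σ ∘ f) z := by
    intro z hz
    have hw : c⁻¹ • z ∈ ball (0 : E) r₂ := inv_smul_mem_ball hc hz
    -- `π (c • F w) = π (F z)` with `w = c⁻¹ • z`
    have hcw : c • c⁻¹ • z = z := by rw [smul_smul, mul_inv_cancel₀ hc0, one_smul]
    have h1 : π (c • σ (f (c⁻¹ • z))) = π (σ (f z)) := by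
      rw [hπ, hσ _ (hballr hw), ← hf, hcw, hσ _ (hballr hz)]
    -- both arguments lie in `ball 0 ρ`
    have hm1 : c • σ (f (c⁻¹ • z)) ∈ ball (0 : E) ρ := by
      rw [mem_ball_zero_iff, norm_smul]
      calc ‖c‖ * ‖σ (f (c⁻¹ • z))‖ < ‖c‖ * (ρ / ‖c‖) := by gcongr; exact hsmall _ (hballr₁ hw)
        _ = ρ := by field_simp
    have hm2 : σ (f z) ∈ ball (0 : E) ρ := by
      rw [mem_ball_zero_iff]
      calc ‖σ (f z)‖ < ρ / ‖c‖ := hsmall _ (hballr₁ hz)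
        _ ≤ ρ := div_le_self hρ.le hc1
    have h2 : c • σ (f (c⁻¹ • z)) = σ (f z) := hinj hm1 hm2 h1
    simp only [Function.comp_apply]
    rw [← h2, smul_smul, inv_mul_cancel₀ hc0, one_smul]
  -- §1: `σ ∘ f = L` on the small ball, hence `f = π ∘ L` there
  have hFL : EqOn (σ ∘ f) L (ball 0 r₂) :=
    eqOn_ball_of_hasFDerivAt_of_smul_inv_equivariant hc hL (by simpa using h0) hFeq
  have hloc : EqOn f (fun z => π (L z)) (ball 0 r₂) := by
    intro z hz
    have := hFL hz
    simp only [Function.comp_apply] at this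
    simp only
    rw [← this, hσ _ (hballr hz)]
  -- §2: spread along orbits
  refine eq_of_smul_equivariant_of_eqOn_ball hc hf (g := fun z => π (L z)) (fun z => ?_) hr₂ hloc
  simp only [map_smul, hπ]

/-- Under the hypotheses of `eq_comp_of_smul_equivariant`, if `f` is injective on some ball `ball 0 r'`, `0 < r'`,
then the linear part `L` is injective. [cite: Milnor2006, §8 Thm. 8.2 (uniqueness) and Cor. 8.4] -/
theorem injective_of_smul_equivariant {M : Type*} {c : 𝕜} (hc : 1 < ‖c‖) {D : M → M} {π f : E → M} {σ : M → E}
    (hπ : ∀ z, π (c • z) = D (π z)) (hf : ∀ z, f (c • z) = D (f z))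
    {ρ r : ℝ} (hρ : 0 < ρ) (hr : 0 < r) (hinj : InjOn π (ball 0 ρ))
    (hσ : ∀ w ∈ ball (0 : E) r, π (σ (f w)) = f w) (h0 : σ (f 0) = 0)
    {L : E →L[𝕜] E} (hL : HasFDerivAt (σ ∘ f) L 0)
    {r' : ℝ} (hr' : 0 < r') (hfinj : InjOn f (ball 0 r')) : Function.Injective L := by
  have hfac := eq_comp_of_smul_equivariant hc hπ hf hρ hr hinj hσ h0 hL
  have hc0 : c ≠ 0 := ne_zero_of_one_lt_norm hc
  refine (injective_iff_map_eq_zero L).mpr fun z hz => ?_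
  -- shrink `z` into the injectivity ball of `f` along the orbit `c⁻ᵏ • z`
  obtain ⟨k, hk⟩ := exists_pow_lt_of_lt_one (div_pos hr' (by positivity : (0 : ℝ) < ‖z‖ + 1))
    (norm_inv_lt_one hc)
  have hmem : (c⁻¹) ^ k • z ∈ ball (0 : E) r' := by
    rw [mem_ball_zero_iff, norm_smul, norm_pow]
    calc ‖c⁻¹‖ ^ k * ‖z‖ ≤ ‖c⁻¹‖ ^ k * (‖z‖ + 1) := by gcongr; linarith
      _ < r' / (‖z‖ + 1) * (‖z‖ + 1) := by gcongr
      _ = r' := by field_simp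
  have hfz : f ((c⁻¹) ^ k • z) = f 0 := by
    rw [hfac]
    simp only [map_smul, hz, smul_zero, map_zero]
  rcases smul_eq_zero.mp (hfinj hmem (mem_ball_self hr') hfz) with h | h
  · exact absurd h (pow_ne_zero _ (inv_ne_zero hc0))
  · exact h

/-- Finite-dimensional packaging over a complete field: under the hypotheses of `injective_of_smul_equivariant`,
`f = π ∘ L'` for a continuous linear AUTOMORPHISM `L'` of `E` (whose underlying map is the derivative `L`).
[cite: Milnor2006, §8 Thm. 8.2 (uniqueness) and Cor. 8.4] -/
theorem exists_continuousLinearEquiv_eq_comp [CompleteSpace 𝕜] [FiniteDimensional 𝕜 E]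
    {M : Type*} {c : 𝕜} (hc : 1 < ‖c‖) {D : M → M} {π f : E → M} {σ : M → E}
    (hπ : ∀ z, π (c • z) = D (π z)) (hf : ∀ z, f (c • z) = D (f z))
    {ρ r : ℝ} (hρ : 0 < ρ) (hr : 0 < r) (hinj : InjOn π (ball 0 ρ))
    (hσ : ∀ w ∈ ball (0 : E) r, π (σ (f w)) = f w) (h0 : σ (f 0) = 0)
    {L : E →L[𝕜] E} (hL : HasFDerivAt (σ ∘ f) L 0)
    {r' : ℝ} (hr' : 0 < r') (hfinj : InjOn f (ball 0 r')) :
    ∃ L' : E ≃L[𝕜] E, (L' : E →L[𝕜] E) = L ∧ f = fun z => π (L' z) := by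
  have hLinj := injective_of_smul_equivariant hc hπ hf hρ hr hinj hσ h0 hL hr' hfinj
  have hfac := eq_comp_of_smul_equivariant hc hπ hf hρ hr hinj hσ h0 hL
  let L₀ : E ≃ₗ[𝕜] E := LinearEquiv.ofInjectiveEndo (L : E →ₗ[𝕜] E) hLinj
  refine ⟨L₀.toContinuousLinearEquiv, ?_, ?_⟩
  · ext z; rfl
  · rw [hfac]
    funext z
    exact congrArg π rfl

end Literature.Analysis.Calculus.DilationEquivariantGerm
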